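import Summits.QuantumFields.YangMills.Theorems.FluctuationComparisonRegPrIntLS2BetaTopLadderIntraBlock
import Literature.MathematicalPhysics.QuantumFieldTheory.Balaban1983to89.T4WilsonGaugeFlatDirection
import HarnessLib

/-!
# S2β · Q11c — RELATIVE CHORDS AND RELATIVE PLAQUETTES UNDER A COMMON GAUGE: `dist1`∕`Re tr` are unchanged, tree agreement transfers, and the intra-block top ladder
# holds for the PLAIN pair when the tree-comb agreement is known for the GAUGE-FIXED pair (any torus, any `GaugeGroup`)

Cell `ym3-torus` (rung R3 = continuum `SU(2)` YM₃ on T³ at fixed lattice data — NOT d = 4, NOT infinite volume, NOT a mass gap, NOT Clay).  Width seat `ym3-torus-px5` (gen 23);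
crux `stmt-QuantumFields-20520`, LINE g18-1 S2β; (TOP-LAD′)'s `c₃` row (px17 g22 FILE 3b∕READ′, px20 (ii)).  THE IDENTIFICATION STEP (my 17:48:16Z (A)) AS LEMMAS: px17's `a_t` reads
PLAIN chords `X ℓ′·X₀ ℓ′⁻¹` of the descended pair, while (4b) ✓`stageChord_treeComb_top` speaks of the STAGE pair `(g j • X, g j • X₀)` — the same gauge `g j` on both sides by the
`AxStage` intertwinings.  Under a COMMON gauge transformation `u`: the relative chord is conjugated by `u` at one endpoint (§1), the relative plaquette by `u` at the plaquette's source
(§2), so `dist1` and `Re tr` of both are UNCHANGED and «`u•W = u•U` on a bond» ⟺ «`W = U` there» (§1); hence (§3) Q11b-lattice ✓p831150 `dist1_chord_le_of_intraBlock` holds for the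
plain pair `(W, U)` as soon as the tree-comb agreement is known for `(u•W, u•U)` — the form the docking file meets.  `--kind proof --supports stmt-QuantumFields-20520 --as helper`,
count-neutral, DEFINITION-FREE (0 `def`, 0 `instance`, 0 `notation`, 0 `sorry`, default heartbeats); generic `P : Params`, ANY `GaugeGroup G`.

WHAT IS PROVED (sorry-free; `simp only [GaugeField.gaugeAct, GaugeField.plaqHol] + group`, `dist1_conj`, `reTr_conj`).
* §1 ★`dist1_gaugeAct_chord` (`dist1 ((u•U) b⁻¹·(u•W) b) = dist1 (U b⁻¹·W b)`), `dist1_gaugeAct_chord'` (the `W·U⁻¹` reading, over ✓`Prop7CurvedJunctionCovariance.gaugeAct_mul_inv_gaugeAct`),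
  ★`gaugeAct_eq_iff` (`(u•W) b = (u•U) b ↔ W b = U b`).
* §2 (over lit ✓`T4WilsonGaugeFlatDirection.plaqHol_gaugeAct` : `(u•U)(∂p) = u(p.src)·U(∂p)·u(p.src)⁻¹`) `relPlaq_gaugeAct_eq_conj`, ★`dist1_relPlaq_gaugeAct`, ★`reTr_relPlaq_gaugeAct` (REL is gauge invariant
  under a common gauge).
* §3 ★★★`dist1_chord_le_of_intraBlock_gaugeAct` — tree-comb agreement for `(u•W, u•U)` + relative plaquettes `≤ ρ` on the block for `(W, U)` ⟹ for every intra-block bond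
  `dist1 (U⟨y,e⟩⁻¹·W⟨y,e⟩) ≤ (Σ_{ν<e} |(y − emb B)_ν|)·ρ`.

HONEST SCOPE.  Group bookkeeping; nothing of Bałaban's analysis is asserted or proved; the AxStage derivation «`g₀ j • iter j U₁ = g j • iter j U₀`» (a rewrite inside the `AxStage`
binder) and the READ′ aggregation are the docking file's; (TOP-LAD)∕(LIFT-LAD′)∕(SCT₁₂₃)∕(ST′)∕(ST), LOC's discharge, «MULT♭-ax»∕«CRIT-ax», (D-stage), h3, GAP♯∘ (`stub_uniformFibreGapOrbit`,
registry 3732b7df UNTOUCHED, 0∕5), S2β, the five registered stubs, 20520, 19936, 19200, `YM3TorusSU2` NOT proved; no summit statement is proved by a helper; rung R3 — NOT d = 4, NOT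
infinite volume, NOT a mass gap, NOT Clay; the Yang–Mills mass gap is NOT proved.

References: T. Bałaban, CMP **98** (1985) 17–51 [Balaban1985Averaging] ((8)–(13) p.18–19: gauge transformations, plaquette variables, gauge invariance); CMP **122** (1989) 355–392
[Balaban1989LargeFieldII] (p.382).
-/

set_option autoImplicit false

namespace Summit.QuantumFields.YangMills.Theorems.FluctuationComparisonRegPrIntLS2BetaRelativeGaugeCovariance

open Literature.MathematicalPhysics.QuantumFieldTheory.Balaban1983to89
open Literature.MathematicalPhysics.QuantumFieldTheory.Balaban1983to89.T4Continuum
open Literature.MathematicalPhysics.QuantumFieldTheory.Balaban1983to89.BlockAveraging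
open B10Eq27TorusAxialLog (rel)
open Summit.QuantumFields.YangMills.Theorems.FluctuationComparisonRegPrIntLS2BetaTopLadderIntraBlock (dist1_chord_le_of_intraBlock)

variable {P : Params} {j : ℕ} {G : Type*} [GaugeGroup G]

/-! ## §1 Relative chords under a common gauge -/

/-- ★ The relative chord's `dist1` is unchanged by a common gauge transformation (`U⁻¹·W` reading): `(u•U)(b)⁻¹·(u•W)(b) = u(b₊)·(U(b)⁻¹·W(b))·u(b₊)⁻¹` (the identity is
✓`NE1pDisplacementTransport.quot_inv_gaugeAct` of the BalabanUV tree; re-derived inline by `group`). [cite: Balaban1985Averaging, (8), (12) p.18–19] -/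
theorem dist1_gaugeAct_chord (u : GaugeTransf P j G) (W U : GaugeField P j G) (b : PBond P j) :
    dist1 ((GaugeField.gaugeAct u U b)⁻¹ * GaugeField.gaugeAct u W b) = dist1 ((U b)⁻¹ * W b) := by
  have h : (GaugeField.gaugeAct u U b)⁻¹ * GaugeField.gaugeAct u W b = u b.tgt * ((U b)⁻¹ * W b) * (u b.tgt)⁻¹ := by
    simp only [GaugeField.gaugeAct]
    group
  rw [h, GaugeGroup.dist1_conj]

/-- ★ The relative chord's `dist1` is unchanged by a common gauge transformation (`W·U⁻¹` reading; the identity `(u•W)(b)·(u•U)(b)⁻¹ = u(b₋)·(W(b)·U(b)⁻¹)·u(b₋)⁻¹` is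
✓`Prop7CurvedJunctionCovariance.gaugeAct_mul_inv_gaugeAct`, reused). [cite: Balaban1985Averaging, (8), (12) p.18–19] -/
theorem dist1_gaugeAct_chord' (u : GaugeTransf P j G) (W U : GaugeField P j G) (b : PBond P j) :
    dist1 (GaugeField.gaugeAct u W b * (GaugeField.gaugeAct u U b)⁻¹) = dist1 (W b * (U b)⁻¹) := by
  rw [Prop7CurvedJunctionCovariance.gaugeAct_mul_inv_gaugeAct, GaugeGroup.dist1_conj]

/-- ★ Agreement on a bond is unchanged by a common gauge transformation. [cite: Balaban1985Averaging, (8) p.18] -/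
theorem gaugeAct_eq_iff (u : GaugeTransf P j G) (W U : GaugeField P j G) (b : PBond P j) :
    GaugeField.gaugeAct u W b = GaugeField.gaugeAct u U b ↔ W b = U b := by
  simp only [GaugeField.gaugeAct]
  constructor
  · intro h
    exact mul_left_cancel (mul_right_cancel h)
  · intro h
    rw [h]

/-! ## §2 Relative plaquettes under a common gauge -/

/-- The RELATIVE plaquette of two configurations under a common gauge is conjugated by `u(p₀)`. [cite: Balaban1985Averaging, (9), (12) p.19] -/
theorem relPlaq_gaugeAct_eq_conj (u : GaugeTransf P j G) (W U : GaugeField P j G) (p : Plaq P j) :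
    (GaugeField.plaqHol (GaugeField.gaugeAct u U) p)⁻¹ * GaugeField.plaqHol (GaugeField.gaugeAct u W) p =
      u p.src * ((GaugeField.plaqHol U p)⁻¹ * GaugeField.plaqHol W p) * (u p.src)⁻¹ := by
  rw [T4WilsonGaugeFlatDirection.plaqHol_gaugeAct, T4WilsonGaugeFlatDirection.plaqHol_gaugeAct]
  group

/-- ★ `dist1` of the relative plaquette is unchanged by a common gauge transformation. [cite: Balaban1985Averaging, (12) p.19] -/
theorem dist1_relPlaq_gaugeAct (u : GaugeTransf P j G) (W U : GaugeField P j G) (p : Plaq P j) :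
    dist1 ((GaugeField.plaqHol (GaugeField.gaugeAct u U) p)⁻¹ * GaugeField.plaqHol (GaugeField.gaugeAct u W) p) =
      dist1 ((GaugeField.plaqHol U p)⁻¹ * GaugeField.plaqHol W p) := by
  rw [relPlaq_gaugeAct_eq_conj, GaugeGroup.dist1_conj]

/-- ★ `Re tr` of the relative plaquette (the summand of REL) is unchanged by a common gauge transformation. [cite: Balaban1985Averaging, (12)-(13) p.19] -/
theorem reTr_relPlaq_gaugeAct (u : GaugeTransf P j G) (W U : GaugeField P j G) (p : Plaq P j) :
    GaugeGroup.reTr ((GaugeField.plaqHol (GaugeField.gaugeAct u U) p)⁻¹ * GaugeField.plaqHol (GaugeField.gaugeAct u W) p) =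
      GaugeGroup.reTr ((GaugeField.plaqHol U p)⁻¹ * GaugeField.plaqHol W p) := by
  rw [relPlaq_gaugeAct_eq_conj, GaugeGroup.reTr_conj]

/-! ## §3 The intra-block top ladder for the plain pair from tree agreement of the gauge-fixed pair -/

/-- ★★★ **THE INTRA-BLOCK TOP LADDER, PLAIN PAIR.**  If the GAUGE-FIXED pair `(u•W, u•U)` agrees on every tree-comb bond of the block `B` (what (4b) ✓`stageChord_treeComb_top` gives at
the top stage on the fibre) and every plaquette of the PLAIN pair with source in `B` has relative size `≤ ρ`, then every bond `⟨y, e⟩` with `y, y + e ∈ B` obeys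
`dist1 (U⟨y,e⟩⁻¹·W⟨y,e⟩) ≤ (Σ_{ν<e} |(y − emb B)_ν|)·ρ`. [cite: Balaban1989LargeFieldII, p.382; Balaban1985Averaging, (8)-(12) p.18-19, (19) p.21] -/
theorem dist1_chord_le_of_intraBlock_gaugeAct (hj : j + 1 ≤ P.m + P.K) (u : GaugeTransf P j G) (W U : GaugeField P j G) (B : Site P (j + 1))
    (htree : ∀ (x : Site P j) (μ : Fin P.d), blockOf x = B → blockOf (x.shift μ) = B → (∀ ν, ν < μ → rel (emb B) x ν = 0) →
      GaugeField.gaugeAct u W ⟨x, μ⟩ = GaugeField.gaugeAct u U ⟨x, μ⟩)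
    {ρ : ℝ} (hρ0 : 0 ≤ ρ) (hρ : ∀ q : Plaq P j, blockOf q.src = B → dist1 ((GaugeField.plaqHol U q)⁻¹ * GaugeField.plaqHol W q) ≤ ρ)
    (y : Site P j) (e' : Fin P.d) (hy : blockOf y = B) (hye : blockOf (y.shift e') = B) :
    dist1 ((U ⟨y, e'⟩)⁻¹ * W ⟨y, e'⟩) ≤ (∑ ν ∈ Finset.univ.filter (fun ν => ν < e'), (rel (emb B) y ν).natAbs) * ρ := by
  have htree' : ∀ (x : Site P j) (μ : Fin P.d), blockOf x = B → blockOf (x.shift μ) = B → (∀ ν, ν < μ → rel (emb B) x ν = 0) →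
      GaugeField.gaugeAct u W ⟨x, μ⟩ = GaugeField.gaugeAct u U ⟨x, μ⟩ := htree
  have hρ' : ∀ q : Plaq P j, blockOf q.src = B →
      dist1 ((GaugeField.plaqHol (GaugeField.gaugeAct u U) q)⁻¹ * GaugeField.plaqHol (GaugeField.gaugeAct u W) q) ≤ ρ := by
    intro q hq
    rw [dist1_relPlaq_gaugeAct]
    exact hρ q hq
  have h := dist1_chord_le_of_intraBlock hj (GaugeField.gaugeAct u W) (GaugeField.gaugeAct u U) B htree' hρ0 hρ' y e' hy hye
  rw [dist1_gaugeAct_chord] at h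
  exact h

/-- ★ The same with the tree agreement stated for the plain pair and the plaquette bound for the gauge-fixed pair (either currency converts: `gaugeAct_eq_iff`, `dist1_relPlaq_gaugeAct`).
[cite: Balaban1985Averaging, (8)-(12) p.18-19] -/
theorem dist1_gaugeAct_chord_le_of_intraBlock (hj : j + 1 ≤ P.m + P.K) (u : GaugeTransf P j G) (W U : GaugeField P j G) (B : Site P (j + 1))
    (htree : ∀ (x : Site P j) (μ : Fin P.d), blockOf x = B → blockOf (x.shift μ) = B → (∀ ν, ν < μ → rel (emb B) x ν = 0) → W ⟨x, μ⟩ = U ⟨x, μ⟩)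
    {ρ : ℝ} (hρ0 : 0 ≤ ρ)
    (hρ : ∀ q : Plaq P j, blockOf q.src = B → dist1 ((GaugeField.plaqHol (GaugeField.gaugeAct u U) q)⁻¹ * GaugeField.plaqHol (GaugeField.gaugeAct u W) q) ≤ ρ)
    (y : Site P j) (e' : Fin P.d) (hy : blockOf y = B) (hye : blockOf (y.shift e') = B) :
    dist1 ((GaugeField.gaugeAct u U ⟨y, e'⟩)⁻¹ * GaugeField.gaugeAct u W ⟨y, e'⟩) ≤
      (∑ ν ∈ Finset.univ.filter (fun ν => ν < e'), (rel (emb B) y ν).natAbs) * ρ := by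
  rw [dist1_gaugeAct_chord]
  have hρ' : ∀ q : Plaq P j, blockOf q.src = B → dist1 ((GaugeField.plaqHol U q)⁻¹ * GaugeField.plaqHol W q) ≤ ρ := by
    intro q hq
    rw [← dist1_relPlaq_gaugeAct u]
    exact hρ q hq
  exact dist1_chord_le_of_intraBlock hj W U B htree hρ0 hρ' y e' hy hye

end Summit.QuantumFields.YangMills.Theorems.FluctuationComparisonRegPrIntLS2BetaRelativeGaugeCovariance
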